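import Summits.HodgeConjecture.HodgeConjecture.Theorems.R90S4SplitCartanAlgebraCube   -- ★ p864038 F1 (this seat): eigenframe, `mem_cartanAlgebra_conj_diagonal_iff`, `hermStar_conj_diagonal`, `det_conj_diagonal_eq_prod`, …
import Literature.NumberTheory.Rogawski1990.CartanRealisation                         -- ★ `conj_mem_unitaryGroup_of_twistGram_eq_mul`, `exists_unitary_conj_of_twistGram_eq`, `det_inv_mul_twistGram`
import HarnessLib

/-!
# R90-TF · S4 «Ch. 13.1–2», (DICT)(1) file F2a — CLASS CALCULUS IN AN EIGENFRAME: the `U(H)`-classes in the stable class of a regular element of a SPLIT Cartan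
# are read on the frame coordinates of the Cartan class `x_g = H⁻¹H_g = g⋆g`, modulo COORDINATEWISE NORMS (Rogawski 1990, §3.5 Prop. 3.5.2 (a) p. 29; §3.6 p. 30)

Cell `hodgecm-mathlib`, crux H413 (`stmt-HodgeConjecture-24833`, lane `--supports … --as helper`), route of record `HCCMUnconditional` (no route verbs; count-neutral).
Programme R90-TF, section S4 (base `R90-C131`), dealer K2E2-plan (g7), hand (DICT)(1) «`(E¹)³` TYPE» (GO 2026-09-05T01:10:20Z, plan F1 → F2 → F3); seat R90-C131-p01 (g2).
File F2a (generic, any field `K`, endomorphism `σ`, `σ`-hermitian invertible `H`, any `N`); F2b instantiates at `K = L ⊗ L⁺_v` (non-split `v`, local norm index `2`,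
Jacobowitz) and counts FOUR classes.  THEOREMS ONLY (no `def`, no instance, no notation, no named fact, no `sorry`); ★-only imports.

## THE MATHEMATICS
Fix a type-(1) element `γ ∈ U(H)(K)` with eigenframe `P` (`γ = P·diag(μ)·P⁻¹`, `μ` injective, `σ(μᵢ)μᵢ = 1`; ★ F1).  Write `[d] := P·diag(d)·P⁻¹`.  By ★ F1, `Z(γ) = {[d]}`,
`[d]⋆ = [σd]`, `det [d] = ∏ dᵢ`.  Then:
* (§1) `[a]·[b] = [ab]`; the unitary elements of `Z(γ)` — the torus `T = Z_U(γ)` — are the `[ν]` with `σ(νᵢ)νᵢ = 1` (`t⋆t = 1`); a regular one (separable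
  characteristic polynomial `∏ (X − νᵢ)`) has `ν` injective, so `Z(t) = Z(γ)` IN THE SAME FRAME.
* (§2) For `g ∈ GL_N(K)` with Cartan class `H_g = H·[c]` (`H_g = ᵗσ(g) H g`, ★ `twistGram`): `H_{g·[d]} = H·[σ(d)·c·d]` (★ `twistGram_mul` + `[d]⋆ = [σd]`); `g t g⁻¹ ∈ U(H)`
  for every `t ∈ T` (★ `conj_mem_unitaryGroup_of_twistGram_eq_mul`).
* (§3) CRITERION [Prop. 3.5.2 (a)]: for `t ∈ T` regular and realisers `g₁, g₂` with classes `[c₁], [c₂]`:  `g₁tg₁⁻¹ ∼_{U(H)} g₂tg₂⁻¹ ⇔ ∃ d ∈ (Kˣ)ᴺ, c₂ = σ(d)·c₁·d`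
  coordinatewise (⇒: two conjugators onto `U`-conjugate elements differ by `u ∈ U` on the left and `s ∈ Z(t)ˣ = {[d]}` on the right, ★ `exists_commute_eq_mul_of_conj_eq`,
  `twistGram_eq_of_unitary_conj`; ⇐: ★ `exists_unitary_conj_of_twistGram_eq` with `s = [d]`).
* (§4) EXHAUSTION: every `g` with `g t g⁻¹ ∈ U(H)` has a class of the form `H·[c]` with `σc = c` and `∏ cᵢ = σ(det g)·det g` — a NORM (★ `inv_mul_twistGram_mem_cartanAlgebra`,
  `hermStar_inv_mul_twistGram`, `det_inv_mul_twistGram`).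
So the `U(H)`-classes inside the stable class of a regular `t ∈ T` inject into `((K₀ˣ)ᴺ ∕ coordinatewise norms)_{∏ ∈ N}` and every such coordinate class that is REALISED (some `g`
with `H_g = H·[c]`, i.e. `H·[c] ≅ H` — Jacobowitz, F2b) occurs: for `N = 3` over a non-split `p`-adic place these are the four `ε ∈ (ℤ∕2)³` with `Σε = 0` [§3.6 p. 30, type (1):
`𝔇(T∕F) ≅ {(a,b,c) ∈ (ℤ∕2)³ : a + b + c = 0}`].

## CONTENTS (generic)
* §1 `conj_diagonal_mul_conj_diagonal`, `commute_conj_diagonal`, `exists_eq_conj_diagonal_of_mem_unitaryGroup_of_commute`, `injective_of_charpoly_conj_diagonal_separable`.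
* §2 `twistGram_mul_conj_diagonal`, `conj_mem_unitaryGroup_of_twistGram_eq_frame`.
* §3 `exists_norm_coords_of_unitary_conj`, `exists_unitary_conj_of_norm_coords`.
* §4 `exists_coords_of_conj_mem_unitaryGroup`.

HONEST LABEL: HC_CM is proved only modulo the 7 printed citations (2 remaining named inputs: hLiu418 = stmt-HodgeConjecture-24832, h413 = stmt-HodgeConjecture-24833) until rung 0
closes.  Generic algebra toward the type-(1) rows of (DICT) behind ★ (B2-S) behind the OPEN (W-NP); discharges no named input.  REL ≠ ★ ≠ BUILT.

## References
* [Rogawski1990] J. D. Rogawski, *Automorphic Representations of Unitary Groups in Three Variables*, Ann. of Math. Stud. 123 (1990), §3.1 p. 19, §3.5 Prop. 3.5.2 (a) p. 29, §3.6 p. 30.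
* [Kottwitz1986] R. E. Kottwitz, *Stable trace formula: elliptic singular terms*, Math. Ann. 275 (1986), §7.
-/

set_option autoImplicit false
set_option linter.dupNamespace false

noncomputable section

open Polynomial Matrix
open scoped MatrixGroups
open Literature.NumberTheory.Rogawski1990
open Literature.AlgebraicGeometry.ShimuraVarieties (unitaryGroup mem_unitaryGroup_iff)

namespace Summit.HodgeConjecture.HodgeConjecture.R90.S4

section Generic

variable {K : Type*} [Field K] {N : ℕ} (σ : K →+* K) (H : Matrix (Fin N) (Fin N) K)

/-! ## §1 Products in the frame; the torus `T = Z_U(γ)` in the frame -/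

omit σ H in
/-- `[a]·[b] = [a·b]` for `[d] := P·diag(d)·P⁻¹`. [cite: Rogawski1990, §3.6 p. 30] -/
theorem conj_diagonal_mul_conj_diagonal (P : GL (Fin N) K) (a b : Fin N → K) :
    P.val * diagonal a * P⁻¹.val * (P.val * diagonal b * P⁻¹.val) = P.val * diagonal (fun i => a i * b i) * P⁻¹.val := by
  have hPi := units_inv_mul_val P
  calc P.val * diagonal a * P⁻¹.val * (P.val * diagonal b * P⁻¹.val)
      = P.val * (diagonal a * diagonal b) * P⁻¹.val := by
        simp only [Matrix.mul_assoc]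
        rw [← Matrix.mul_assoc P⁻¹.val P.val, hPi, Matrix.one_mul]
    _ = P.val * diagonal (fun i => a i * b i) * P⁻¹.val := by rw [diagonal_mul_diagonal]

omit σ H in
/-- `[a]` and `[b]` commute. [cite: Rogawski1990, §3.6 p. 30] -/
theorem commute_conj_diagonal (P : GL (Fin N) K) (a b : Fin N → K) :
    Commute (P.val * diagonal a * P⁻¹.val) (P.val * diagonal b * P⁻¹.val) := by
  show _ * _ = _ * _
  rw [conj_diagonal_mul_conj_diagonal, conj_diagonal_mul_conj_diagonal,
    show (fun i => a i * b i) = (fun i => b i * a i) from funext fun i => mul_comm (a i) (b i)]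

/-- **THE TORUS IN THE FRAME**: a UNITARY element commuting with the type-(1) element `γ = P·diag(μ)·P⁻¹` is `[ν] = P·diag(ν)·P⁻¹` with `σ(νᵢ)νᵢ = 1` (it lies in
`Z(γ) = P·Diag·P⁻¹`, ★ F1, and `t⋆t = 1` reads `[σ(ν)ν] = [1]`). [cite: Rogawski1990, §3.6 p. 30] -/
theorem exists_eq_conj_diagonal_of_mem_unitaryGroup_of_commute {γ : GL (Fin N) K} (hγ : γ ∈ unitaryGroup σ H) {μ : Fin N → K} (hinj : Function.Injective μ)
    (hμ : ∀ i, σ (μ i) * μ i = 1) (P : GL (Fin N) K) (hP : γ.val = P.val * diagonal μ * P⁻¹.val) (hH : IsUnit H.det)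
    {t : GL (Fin N) K} (ht : t ∈ unitaryGroup σ H) (htc : Commute t.val γ.val) :
    ∃ ν : Fin N → K, t.val = P.val * diagonal ν * P⁻¹.val ∧ ∀ i, σ (ν i) * ν i = 1 := by
  have hmem : t.val ∈ cartanAlgebra γ.val := mem_cartanAlgebra_iff.2 htc
  rw [hP] at hmem
  obtain ⟨ν, hν⟩ := (mem_cartanAlgebra_conj_diagonal_iff hinj P t.val).1 hmem
  refine ⟨ν, hν, fun i => ?_⟩
  have h1 := hermStar_mul_self_of_mem_unitaryGroup σ H hH ht
  rw [hν, hermStar_mul_self_conj_diagonal σ H hγ hinj hμ P hP hH ν] at h1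
  have h2 : P.val * diagonal (fun i => σ (ν i) * ν i) * P⁻¹.val = P.val * diagonal (fun _ => (1 : K)) * P⁻¹.val := by
    rw [h1, diagonal_one, Matrix.mul_one, units_mul_inv_val]
  exact congrFun (conj_diagonal_injective P h2) i

omit σ H in
/-- A REGULAR element of the split Cartan (separable characteristic polynomial, ★ `IsRegularElt` unfolded) has pairwise distinct coordinates: `charpoly [ν] = ∏ (X − νᵢ)` is
separable iff `ν` is injective. [cite: Rogawski1990, §3.1 p. 19] -/
theorem injective_of_charpoly_conj_diagonal_separable (P : GL (Fin N) K) {ν : Fin N → K} {t : GL (Fin N) K} (htν : t.val = P.val * diagonal ν * P⁻¹.val)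
    (hreg : (t.val).charpoly.Separable) : Function.Injective ν := by
  rw [htν, Matrix.coe_units_inv, Matrix.charpoly_units_conj, charpoly_diagonal] at hreg
  exact separable_prod_X_sub_C_iff.1 hreg

omit σ H in
/-- Conversely distinct coordinates give a regular element (separable characteristic polynomial). [cite: Rogawski1990, §3.1 p. 19] -/
theorem charpoly_conj_diagonal_separable_of_injective (P : GL (Fin N) K) {ν : Fin N → K} {t : GL (Fin N) K} (htν : t.val = P.val * diagonal ν * P⁻¹.val)
    (hν : Function.Injective ν) : (t.val).charpoly.Separable := by
  rw [htν, Matrix.coe_units_inv, Matrix.charpoly_units_conj, charpoly_diagonal]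
  exact separable_prod_X_sub_C_iff.2 hν

/-! ## §2 The Cartan class of `g·[d]` and the realised elements -/

/-- **`H_{g·[d]} = H·[σ(d)·c·d]` when `H_g = H·[c]`** (`H_g = ᵗσ(g) H g`, ★ `twistGram_mul`; `ᵗσ([d]) H = H [d]⋆ = H [σd]`, ★ F1 `hermStar_conj_diagonal`).
[cite: Rogawski1990, §3.5 Prop. 3.5.2 (a) p. 29] -/
theorem twistGram_mul_conj_diagonal {γ : GL (Fin N) K} (hγ : γ ∈ unitaryGroup σ H) {μ : Fin N → K} (hinj : Function.Injective μ)
    (hμ : ∀ i, σ (μ i) * μ i = 1) (P : GL (Fin N) K) (hP : γ.val = P.val * diagonal μ * P⁻¹.val) (hH : IsUnit H.det)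
    {g : Matrix (Fin N) (Fin N) K} {c : Fin N → K} (hg : twistGram σ H g = H * (P.val * diagonal c * P⁻¹.val)) (d : Fin N → K) :
    twistGram σ H (g * (P.val * diagonal d * P⁻¹.val)) = H * (P.val * diagonal (fun i => σ (d i) * c i * d i) * P⁻¹.val) := by
  have hstar : ((P.val * diagonal d * P⁻¹.val).map σ)ᵀ * H = H * hermStar σ H (P.val * diagonal d * P⁻¹.val) := by
    rw [hermStar_def, ← Matrix.mul_assoc, ← Matrix.mul_assoc, Matrix.mul_nonsing_inv H hH, Matrix.one_mul]
  rw [twistGram_mul, hg]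
  calc ((P.val * diagonal d * P⁻¹.val).map σ)ᵀ * (H * (P.val * diagonal c * P⁻¹.val)) * (P.val * diagonal d * P⁻¹.val)
      = ((P.val * diagonal d * P⁻¹.val).map σ)ᵀ * H * ((P.val * diagonal c * P⁻¹.val) * (P.val * diagonal d * P⁻¹.val)) := by
        simp only [Matrix.mul_assoc]
    _ = H * (hermStar σ H (P.val * diagonal d * P⁻¹.val) * ((P.val * diagonal c * P⁻¹.val) * (P.val * diagonal d * P⁻¹.val))) := by
        rw [hstar, Matrix.mul_assoc]
    _ = H * (P.val * diagonal (fun i => σ (d i) * c i * d i) * P⁻¹.val) := by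
        rw [hermStar_conj_diagonal σ H hγ hinj hμ P hP hH d, conj_diagonal_mul_conj_diagonal, conj_diagonal_mul_conj_diagonal]
        simp only [mul_assoc]

/-- **REALISED CLASSES GIVE UNITARY ELEMENTS**: if `H_g = H·[c]` then `g t g⁻¹ ∈ U(H)` for every unitary `t = [ν]` of the frame (★ `conj_mem_unitaryGroup_of_twistGram_eq_mul`:
`[c]` commutes with `[ν]`). [cite: Rogawski1990, §3.1 p. 19; §3.3 Prop. 3.3.1 p. 22] -/
theorem conj_mem_unitaryGroup_of_twistGram_eq_frame (P : GL (Fin N) K) {t : GL (Fin N) K} (ht : t ∈ unitaryGroup σ H) {ν : Fin N → K}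
    (htν : t.val = P.val * diagonal ν * P⁻¹.val) {g : GL (Fin N) K} {c : Fin N → K} (hg : twistGram σ H g.val = H * (P.val * diagonal c * P⁻¹.val)) :
    g * t * g⁻¹ ∈ unitaryGroup σ H := by
  refine conj_mem_unitaryGroup_of_twistGram_eq_mul σ H ht (x := P.val * diagonal c * P⁻¹.val) ?_ hg
  rw [htν]
  exact commute_conj_diagonal P c ν

/-! ## §3 The criterion: `U(H)`-conjugate iff the frame classes differ by coordinatewise norms -/

/-- **(⇒) `U(H)`-CONJUGATE REALISATIONS HAVE NORM-EQUIVALENT FRAME CLASSES**: for `t = [ν]` regular (`ν` injective) and `g₁, g₂` with `H_{g_k} = H·[c_k]`, if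
`g₁tg₁⁻¹ ∼_{U(H)} g₂tg₂⁻¹` then `c₂ = σ(d)·c₁·d` for some `d ∈ (Kˣ)ᴺ` (the conjugators differ by `u ∈ U(H)` and `s ∈ Z(t)ˣ = {[d]}`). [cite: Rogawski1990, §3.5 Prop. 3.5.2 (a) p. 29] -/
theorem exists_norm_coords_of_unitary_conj {γ : GL (Fin N) K} (hγ : γ ∈ unitaryGroup σ H) {μ : Fin N → K} (hinj : Function.Injective μ)
    (hμ : ∀ i, σ (μ i) * μ i = 1) (P : GL (Fin N) K) (hP : γ.val = P.val * diagonal μ * P⁻¹.val) (hH : IsUnit H.det)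
    {t : GL (Fin N) K} {ν : Fin N → K} (hν : Function.Injective ν) (htν : t.val = P.val * diagonal ν * P⁻¹.val)
    {g₁ g₂ : GL (Fin N) K} {c₁ c₂ : Fin N → K}
    (hg₁ : twistGram σ H g₁.val = H * (P.val * diagonal c₁ * P⁻¹.val)) (hg₂ : twistGram σ H g₂.val = H * (P.val * diagonal c₂ * P⁻¹.val))
    (h : ∃ u : GL (Fin N) K, u ∈ unitaryGroup σ H ∧ u * (g₁ * t * g₁⁻¹) * u⁻¹ = g₂ * t * g₂⁻¹) :
    ∃ d : Fin N → K, (∀ i, d i ≠ 0) ∧ ∀ i, c₂ i = σ (d i) * c₁ i * d i := by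
  obtain ⟨u, hu, huc⟩ := h
  obtain ⟨h1, h2⟩ := twistGram_eq_of_unitary_conj σ H hu (rfl : g₁ * t * g₁⁻¹ = g₁ * t * g₁⁻¹)
  rw [huc] at h1
  obtain ⟨s, hs, hg₂s⟩ := exists_commute_eq_mul_of_conj_eq h1 (rfl : g₂ * t * g₂⁻¹ = g₂ * t * g₂⁻¹)
  -- `s ∈ Z(t) = P·Diag·P⁻¹`
  have hsZ : s.val ∈ cartanAlgebra (P.val * diagonal ν * P⁻¹.val) := by
    rw [← htν, mem_cartanAlgebra_iff]
    have := congrArg Units.val hs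
    rw [Units.val_mul, Units.val_mul] at this
    exact this
  obtain ⟨d, hd⟩ := (mem_cartanAlgebra_conj_diagonal_iff hν P s.val).1 hsZ
  refine ⟨d, fun i h0 => ?_, fun i => ?_⟩
  · have hdet := (Matrix.isUnits_det_units s).ne_zero
    rw [hd, det_conj_diagonal_eq_prod] at hdet
    exact hdet (Finset.prod_eq_zero (Finset.mem_univ i) h0)
  · have h3 : twistGram σ H g₂.val = H * (P.val * diagonal (fun i => σ (d i) * c₁ i * d i) * P⁻¹.val) := by
      rw [hg₂s, Units.val_mul, hd]
      exact twistGram_mul_conj_diagonal σ H hγ hinj hμ P hP hH (by rw [h2]; exact hg₁) d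
    rw [hg₂] at h3
    have h4 := congrArg (fun M => H⁻¹ * M) h3
    simp only [← Matrix.mul_assoc, Matrix.nonsing_inv_mul H hH, Matrix.one_mul] at h4
    exact congrFun (conj_diagonal_injective P h4) i

/-- **(⇐) NORM-EQUIVALENT FRAME CLASSES GIVE `U(H)`-CONJUGATE REALISATIONS**: if `c₂ = σ(d)·c₁·d` with `d ∈ (Kˣ)ᴺ` then `g₂tg₂⁻¹ ∼_{U(H)} g₁tg₁⁻¹` for every `t = [ν]` of the
frame (★ `exists_unitary_conj_of_twistGram_eq` with `s = [d] ∈ Z(t)`: `H_{g₂} = H_{g₁ s}`). [cite: Rogawski1990, §3.5 Prop. 3.5.2 (a) p. 29] -/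
theorem exists_unitary_conj_of_norm_coords {γ : GL (Fin N) K} (hγ : γ ∈ unitaryGroup σ H) {μ : Fin N → K} (hinj : Function.Injective μ)
    (hμ : ∀ i, σ (μ i) * μ i = 1) (P : GL (Fin N) K) (hP : γ.val = P.val * diagonal μ * P⁻¹.val) (hH : IsUnit H.det)
    {t : GL (Fin N) K} {ν : Fin N → K} (htν : t.val = P.val * diagonal ν * P⁻¹.val)
    {g₁ g₂ : GL (Fin N) K} {c₁ c₂ : Fin N → K}
    (hg₁ : twistGram σ H g₁.val = H * (P.val * diagonal c₁ * P⁻¹.val)) (hg₂ : twistGram σ H g₂.val = H * (P.val * diagonal c₂ * P⁻¹.val))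
    {d : Fin N → K} (hd0 : ∀ i, d i ≠ 0) (hc : ∀ i, c₂ i = σ (d i) * c₁ i * d i) :
    ∃ u : GL (Fin N) K, u ∈ unitaryGroup σ H ∧ u * (g₂ * t * g₂⁻¹) * u⁻¹ = g₁ * t * g₁⁻¹ := by
  have hdet : (P.val * diagonal d * P⁻¹.val).det ≠ 0 := by
    rw [det_conj_diagonal_eq_prod]
    exact Finset.prod_ne_zero_iff.2 fun i _ => hd0 i
  let s : GL (Fin N) K := Matrix.GeneralLinearGroup.mkOfDetNeZero (P.val * diagonal d * P⁻¹.val) hdet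
  have hsval : s.val = P.val * diagonal d * P⁻¹.val := rfl
  have hst : s * t = t * s := by
    apply Units.ext
    rw [Units.val_mul, Units.val_mul, hsval, htν]
    exact (commute_conj_diagonal P d ν).eq
  refine exists_unitary_conj_of_twistGram_eq σ H (rfl : g₁ * t * g₁⁻¹ = g₁ * t * g₁⁻¹) (rfl : g₂ * t * g₂⁻¹ = g₂ * t * g₂⁻¹) hst ?_
  rw [Units.val_mul, hsval, twistGram_mul_conj_diagonal σ H hγ hinj hμ P hP hH hg₁ d, hg₂,
    show c₂ = (fun i => σ (d i) * c₁ i * d i) from funext hc]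

/-! ## §4 Exhaustion: every stable conjugator of a regular torus element has a `σ`-fixed frame class with NORM determinant -/

/-- **EVERY STABLE CONJUGATOR HAS A FRAME CLASS**: if `t = [ν]` is a regular unitary element of the frame (`ν` injective) and `g t g⁻¹ ∈ U(H)`, then `H_g = H·[c]` with `σ(c) = c`
and `∏ cᵢ = σ(det g)·det g` (★ `inv_mul_twistGram_mem_cartanAlgebra`, `hermStar_inv_mul_twistGram`, `det_inv_mul_twistGram`; ★ F1 for the frame reading).
[cite: Rogawski1990, §3.5 Prop. 3.5.2 (a) p. 29] [cite: Kottwitz1986, §7] -/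
theorem exists_coords_of_conj_mem_unitaryGroup {γ : GL (Fin N) K} (hγ : γ ∈ unitaryGroup σ H) {μ : Fin N → K} (hinj : Function.Injective μ)
    (hμ : ∀ i, σ (μ i) * μ i = 1) (P : GL (Fin N) K) (hP : γ.val = P.val * diagonal μ * P⁻¹.val) (hH : IsUnit H.det)
    (hσ : ∀ r : K, σ (σ r) = r) (hHh : (H.map σ)ᵀ = H)
    {t : GL (Fin N) K} (ht : t ∈ unitaryGroup σ H) {ν : Fin N → K} (hν : Function.Injective ν) (htν : t.val = P.val * diagonal ν * P⁻¹.val)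
    {g : GL (Fin N) K} (hgt : g * t * g⁻¹ ∈ unitaryGroup σ H) :
    ∃ c : Fin N → K, twistGram σ H g.val = H * (P.val * diagonal c * P⁻¹.val) ∧ (∀ i, σ (c i) = c i) ∧ ∏ i, c i = σ g.val.det * g.val.det := by
  have hx : H⁻¹ * twistGram σ H g.val ∈ cartanAlgebra ((((⟨t, ht⟩ : unitaryGroup σ H) : GL (Fin N) K)) : Matrix (Fin N) (Fin N) K) :=
    inv_mul_twistGram_mem_cartanAlgebra σ H hH (γ := ⟨t, ht⟩) (δ := ⟨g * t * g⁻¹, hgt⟩) rfl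
  have hx' : H⁻¹ * twistGram σ H g.val ∈ cartanAlgebra (P.val * diagonal ν * P⁻¹.val) := by rw [← htν]; exact hx
  obtain ⟨c, hc⟩ := (mem_cartanAlgebra_conj_diagonal_iff hν P _).1 hx'
  refine ⟨c, ?_, ?_, ?_⟩
  · rw [← hc, ← Matrix.mul_assoc, Matrix.mul_nonsing_inv H hH, Matrix.one_mul]
  · have hfix := hermStar_inv_mul_twistGram σ H hH hσ hHh g.val
    rw [hc] at hfix
    exact (hermStar_conj_diagonal_eq_self_iff σ H hγ hinj hμ P hP hH c).1 hfix
  · rw [← det_conj_diagonal_eq_prod P c, ← hc, det_inv_mul_twistGram σ H hH]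

end Generic

end Summit.HodgeConjecture.HodgeConjecture.R90.S4

end
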